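import Literature.Analysis.Calculus.HadamardLemma
import Mathlib.Analysis.SpecialFunctions.Sqrt
import Mathlib.Analysis.InnerProductSpace.Calculus
import HarnessLib

/-!
# Whitney's theorem on even functions, smooth case, with parameters

Topic `Literature/Analysis/Calculus`.  H. Whitney, *Differentiable even functions*, Duke Math. J.
10 (1943) 159–160, Thm. 1: "An even function `f(x)` may be written as `g(x²)`.  If `f` is … of
class `C^∞`, `g` may be made … of class `C^∞`."  We prove the smooth case, uniformly in a
parameter `z ∈ P` (finite-dimensional) and for vector-valued functions, in the following
one-sided form, which is exactly what is needed to see that axisymmetric quantities such as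
`u_r / r` of a smooth axisymmetric vector field are smooth across the axis
(`Literature/Analysis/FluidPDE`, the `(J, Ω)` calculus of Lei–Zhang 2017):

* `contDiffOn_comp_sqrt_of_even` — if `F : ℝ × P → E` is `C^∞` and even in the first variable,
  then `(s, z) ↦ F (√s, z)` is `C^∞` on the closed half-space `{s ≥ 0}` (`Ici 0 ×ˢ univ`), in
  the sense of `ContDiffOn` (iterated derivatives within the half-space).

Consequently (chain rule within sets) `x ↦ F (‖x'‖, z(x))` is `C^∞` on a Euclidean space whenever
`x'`, `z` depend smoothly on `x` — e.g. `F (cylRadius x, x₂)` on `ℝ³`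
(`contDiff_comp_norm_of_even`).

## Proof (induction on the order, for all even smooth `F` at once)

Write `∂ᵨF (ρ, z) = DF(ρ, z)(1, 0)` and `∂_P F (ρ, z) = DF(ρ, z) ∘ inr`.  For `F` even, `∂ᵨF`
is odd and vanishes at `ρ = 0`, so Hadamard's lemma in the variable `ρ` (with parameter `z`),
`A (ρ, z) = ∫₀¹ ∂ᵨF (tρ, z) dt`, gives `F (ρ, z) − F (0, z) = ρ • A (ρ, z)` with `A` smooth and odd,
and once more `A = ρ • B`, `B (ρ, z) = ∫₀¹ ∂ᵨA (tρ, z) dt` smooth and even; thus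

  `F (ρ, z) = F (0, z) + ρ² • B (ρ, z)`,  `G (s, z) := F (√s, z) = F (0, z) + s • B (√s, z)` (`s ≥ 0`).

From the second form, `G` has at every point `(s, z)` of the half-space the derivative (within
the half-space) `(σ, ζ) ↦ σ • C (√s, z) + D (√s, z) ζ` with
`C = B + (ρ/2) • ∂ᵨB`, `D (ρ, z) = ∂_P F (0, z) + ρ² • ∂_P B (ρ, z)` — at `s > 0` by the chain rule
(`√` is smooth there), at `s = 0` because `s • (continuous)` has derivative `σ • B (0, z)`
(`hasFDerivWithinAt_fst_smul_of_continuousWithinAt`).  Both `C` and `D` are again smooth and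
even, so the induction hypothesis (order `n`, applied to `C` and to `D`) shows that this derivative
is `Cⁿ` on the half-space, whence `G` is `Cⁿ⁺¹` (`contDiffOn_succ_iff_fderivWithin`).  This is
the classical induction "`g'(s) = f'(√s)/(2√s)` is of the same form" (Whitney, loc. cit.), run
on the half-space so that no extension to `s < 0` is needed.

## Mathlib / tree search

Mathlib has `Real.sqrt` with `Real.hasDerivAt_sqrt` (used here off the boundary) and smoothness
of `√` away from `0` (`Real.contDiffAt_sqrt`), but no form of Whitney's theorem
(`lean search 'Whitney|comp_sqrt|even.*sqrt'`: nothing relevant); the tree has Hadamard's lemma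
with parameters (`Literature.Analysis.Calculus.contDiff_intervalIntegral`, used for the quotients
`A`, `B`) and the coordinate Hadamard quotient `hadamardQuotFst` on `ℝ³` (`FluidPDE/HadamardQuotient`),
the first-order member of the same circle of ideas.

## References

* H. Whitney, *Differentiable even functions*, Duke Math. J. 10 (1943), 159–160, Thm. 1 and its
  proof. [folklore]
* J. Dieudonné, *Foundations of Modern Analysis* (1960), (8.11.2) (differentiation under the
  integral sign, through `contDiff_intervalIntegral`).
-/

open Set Function Filter MeasureTheory intervalIntegral
open scoped Topology ContDiff

noncomputable section

set_option maxSynthPendingDepth 2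

namespace Literature.Analysis.Calculus

universe u

variable {P : Type u} [NormedAddCommGroup P] [NormedSpace ℝ P]
variable {E : Type u} [NormedAddCommGroup E] [NormedSpace ℝ E]

/-! ### Parity of derivatives under the reflection `(ρ, z) ↦ (−ρ, z)` -/

/-- Chain rule through the reflection `N (ρ, z) = (−ρ, z)`:
`D(G ∘ N)(p) v = DG(N p)(N v)`. [folklore] -/
theorem fderiv_comp_negFst_apply {G : ℝ × P → E} (hG : Differentiable ℝ G) (p v : ℝ × P) :
    fderiv ℝ (fun q : ℝ × P => G (-q.1, q.2)) p v = fderiv ℝ G (-p.1, p.2) (-v.1, v.2) := by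
  have hN : HasFDerivAt (fun q : ℝ × P => ((-q.1, q.2) : ℝ × P))
      ((-(ContinuousLinearMap.fst ℝ ℝ P)).prod (ContinuousLinearMap.snd ℝ ℝ P)) p :=
    (hasFDerivAt_fst.neg).prodMk hasFDerivAt_snd
  have h : HasFDerivAt (fun q : ℝ × P => G (-q.1, q.2))
      ((fderiv ℝ G (-p.1, p.2)).comp
        ((-(ContinuousLinearMap.fst ℝ ℝ P)).prod (ContinuousLinearMap.snd ℝ ℝ P))) p :=
    (hG (-p.1, p.2)).hasFDerivAt.comp p hN
  rw [h.fderiv]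
  simp

/-- **Parity of the derivative.** If `G (−ρ, z) = c • G (ρ, z)` for all `(ρ, z)` (e.g. `c = 1`:
even, `c = −1`: odd), then `DG(−ρ, z)(−σ, ζ) = c • DG(ρ, z)(σ, ζ)`. [folklore] -/
theorem fderiv_apply_negFst_of_parity {G : ℝ × P → E} (hG : Differentiable ℝ G) {c : ℝ}
    (h : ∀ ρ (z : P), G (-ρ, z) = c • G (ρ, z)) (p v : ℝ × P) :
    fderiv ℝ G (-p.1, p.2) (-v.1, v.2) = c • fderiv ℝ G p v := by
  have hfun : (fun q : ℝ × P => G (-q.1, q.2)) = fun q => c • G q := funext fun q => h q.1 q.2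
  have h1 := fderiv_comp_negFst_apply hG p v
  rw [hfun, fderiv_fun_const_smul (hG p)] at h1
  simpa using h1.symm

/-- For an **even** function, `∂ᵨF` is odd: `DF(−ρ, z)(1, 0) = −DF(ρ, z)(1, 0)`. [folklore] -/
theorem fderiv_fst_neg_of_even {F : ℝ × P → E} (hF : Differentiable ℝ F)
    (h : ∀ ρ (z : P), F (-ρ, z) = F (ρ, z)) (ρ : ℝ) (z : P) :
    fderiv ℝ F (-ρ, z) ((1 : ℝ), (0 : P)) = -fderiv ℝ F (ρ, z) ((1 : ℝ), (0 : P)) := by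
  have h1 := fderiv_apply_negFst_of_parity hF (c := 1) (fun ρ z => by rw [h, one_smul]) (ρ, z)
    ((-1 : ℝ), (0 : P))
  simp only [neg_neg, one_smul] at h1
  have h2 : fderiv ℝ F (ρ, z) ((-1 : ℝ), (0 : P)) = -fderiv ℝ F (ρ, z) ((1 : ℝ), (0 : P)) := by
    rw [show ((-1 : ℝ), (0 : P)) = -((1 : ℝ), (0 : P)) by simp, map_neg]
  rw [h1, h2]

/-- For an **odd** function, `∂ᵨG` is even: `DG(−ρ, z)(1, 0) = DG(ρ, z)(1, 0)`. [folklore] -/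
theorem fderiv_fst_eq_of_odd {G : ℝ × P → E} (hG : Differentiable ℝ G)
    (h : ∀ ρ (z : P), G (-ρ, z) = -G (ρ, z)) (ρ : ℝ) (z : P) :
    fderiv ℝ G (-ρ, z) ((1 : ℝ), (0 : P)) = fderiv ℝ G (ρ, z) ((1 : ℝ), (0 : P)) := by
  have h1 := fderiv_apply_negFst_of_parity hG (c := -1) (fun ρ z => by rw [h, neg_one_smul])
    (ρ, z) ((-1 : ℝ), (0 : P))
  simp only [neg_neg, neg_one_smul] at h1
  have h2 : fderiv ℝ G (ρ, z) ((-1 : ℝ), (0 : P)) = -fderiv ℝ G (ρ, z) ((1 : ℝ), (0 : P)) := by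
    rw [show ((-1 : ℝ), (0 : P)) = -((1 : ℝ), (0 : P)) by simp, map_neg]
  rw [h2, neg_neg] at h1
  exact h1

/-- For an **even** function, `∂_P F` is even: `DF(−ρ, z)(0, ζ) = DF(ρ, z)(0, ζ)`. [folklore] -/
theorem fderiv_snd_eq_of_even {F : ℝ × P → E} (hF : Differentiable ℝ F)
    (h : ∀ ρ (z : P), F (-ρ, z) = F (ρ, z)) (ρ : ℝ) (z ζ : P) :
    fderiv ℝ F (-ρ, z) ((0 : ℝ), ζ) = fderiv ℝ F (ρ, z) ((0 : ℝ), ζ) := by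
  have h1 := fderiv_apply_negFst_of_parity hF (c := 1) (fun ρ z => by rw [h, one_smul]) (ρ, z)
    ((0 : ℝ), ζ)
  simpa using h1

omit [NormedAddCommGroup P] [NormedSpace ℝ P] in
/-- An odd function vanishes on `{ρ = 0}`. [folklore] -/
theorem eq_zero_of_odd {G : ℝ × P → E} (h : ∀ ρ (z : P), G (-ρ, z) = -G (ρ, z)) (z : P) :
    G (0, z) = 0 := by
  have h1 := h 0 z
  rw [neg_zero] at h1
  have h2 : (2 : ℝ) • G (0, z) = 0 := by
    rw [two_smul]
    nth_rw 2 [h1]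
    exact add_neg_cancel (G (0, z))
  exact (smul_eq_zero.1 h2).resolve_left two_ne_zero

/-! ### Hadamard's quotient in the first variable, with parameter -/

section Hadamard

variable [CompleteSpace E]

/-- **Hadamard's lemma in the variable `ρ`** (fundamental theorem of calculus along
`t ↦ G (tρ, z)`): `ρ • ∫₀¹ ∂ᵨG (tρ, z) dt = G (ρ, z) − G (0, z)` for `G ∈ C¹`. [folklore] -/
theorem smul_integral_fderiv_fst_eq_sub {G : ℝ × P → E} (hG : ContDiff ℝ 1 G) (ρ : ℝ) (z : P) :
    ρ • (∫ t in (0 : ℝ)..1, fderiv ℝ G (t * ρ, z) ((1 : ℝ), (0 : P))) = G (ρ, z) - G (0, z) := by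
  have hd : Differentiable ℝ G := hG.differentiable one_ne_zero
  have hc : Continuous (fderiv ℝ G) := hG.continuous_fderiv one_ne_zero
  have hφ : ∀ t : ℝ, HasDerivAt (fun t : ℝ => G (t * ρ, z))
      (ρ • fderiv ℝ G (t * ρ, z) ((1 : ℝ), (0 : P))) t := by
    intro t
    have hl : HasDerivAt (fun t : ℝ => ((t * ρ, z) : ℝ × P)) ((ρ, 0) : ℝ × P) t := by
      have := ((hasDerivAt_id t).mul_const ρ).prodMk (hasDerivAt_const t z)
      simpa using this
    have h := (hd (t * ρ, z)).hasFDerivAt.comp_hasDerivAt t hl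
    have e : fderiv ℝ G (t * ρ, z) ((ρ, 0) : ℝ × P) =
        ρ • fderiv ℝ G (t * ρ, z) ((1 : ℝ), (0 : P)) := by
      rw [show ((ρ, 0) : ℝ × P) = ρ • ((1 : ℝ), (0 : P)) by simp, map_smul]
    rw [e] at h
    exact h
  have hint : IntervalIntegrable (fun t : ℝ => ρ • fderiv ℝ G (t * ρ, z) ((1 : ℝ), (0 : P)))
      volume 0 1 := by
    refine (Continuous.intervalIntegrable ?_ 0 1)
    have h1 : Continuous fun t : ℝ => fderiv ℝ G (t * ρ, z) := hc.comp (by fun_prop)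
    exact (h1.clm_apply continuous_const).const_smul ρ
  have h := integral_eq_sub_of_hasDerivAt (fun t _ => hφ t) hint
  rw [intervalIntegral.integral_smul] at h
  simpa using h

/-- The Hadamard quotient `(ρ, z) ↦ ∫₀¹ ∂ᵨG (tρ, z) dt` of a smooth function is smooth
(differentiation under the integral sign, `contDiff_intervalIntegral`). [folklore] -/
theorem contDiff_integral_fderiv_fst [FiniteDimensional ℝ P] {G : ℝ × P → E}
    (hG : ContDiff ℝ ∞ G) :
    ContDiff ℝ ∞ (fun p : ℝ × P => ∫ t in (0 : ℝ)..1, fderiv ℝ G (t * p.1, p.2) ((1 : ℝ), (0 : P))) := by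
  have h1 : ContDiff ℝ ∞ (fun p : ℝ × P => fderiv ℝ G p ((1 : ℝ), (0 : P))) :=
    (hG.fderiv_right (m := ∞) (by simp)).clm_apply contDiff_const
  have h2 : ContDiff ℝ ∞ (uncurry fun (p : ℝ × P) (t : ℝ) =>
      fderiv ℝ G (t * p.1, p.2) ((1 : ℝ), (0 : P))) := by
    have hm : ContDiff ℝ ∞ (fun q : (ℝ × P) × ℝ => ((q.2 * q.1.1, q.1.2) : ℝ × P)) := by fun_prop
    exact h1.comp hm
  exact contDiff_intervalIntegral (n := ⊤) h2 0 1

omit [CompleteSpace E] in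
/-- The Hadamard quotient of a function with even `∂ᵨ` (e.g. an odd function) is even. [folklore] -/
theorem integral_fderiv_fst_even {G : ℝ × P → E}
    (h : ∀ ρ (z : P), fderiv ℝ G (-ρ, z) ((1 : ℝ), (0 : P)) = fderiv ℝ G (ρ, z) ((1 : ℝ), (0 : P)))
    (ρ : ℝ) (z : P) :
    (∫ t in (0 : ℝ)..1, fderiv ℝ G (t * -ρ, z) ((1 : ℝ), (0 : P))) =
      ∫ t in (0 : ℝ)..1, fderiv ℝ G (t * ρ, z) ((1 : ℝ), (0 : P)) := by
  refine integral_congr fun t _ => ?_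
  simp only [mul_neg]
  exact h (t * ρ) z

omit [CompleteSpace E] in
/-- The Hadamard quotient of a function with odd `∂ᵨ` (e.g. an even function) is odd. [folklore] -/
theorem integral_fderiv_fst_odd {G : ℝ × P → E}
    (h : ∀ ρ (z : P), fderiv ℝ G (-ρ, z) ((1 : ℝ), (0 : P)) = -fderiv ℝ G (ρ, z) ((1 : ℝ), (0 : P)))
    (ρ : ℝ) (z : P) :
    (∫ t in (0 : ℝ)..1, fderiv ℝ G (t * -ρ, z) ((1 : ℝ), (0 : P))) =
      -∫ t in (0 : ℝ)..1, fderiv ℝ G (t * ρ, z) ((1 : ℝ), (0 : P)) := by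
  rw [← intervalIntegral.integral_neg]
  refine integral_congr fun t _ => ?_
  simp only [mul_neg]
  exact h (t * ρ) z

end Hadamard

/-! ### Two derivative computations on the half-space -/

/-- **`s • (continuous)` is differentiable at `s = 0`**: if `M` is continuous at `(0, z)` within
`S`, then `p ↦ p.1 • M p` has derivative `(σ, ζ) ↦ σ • M (0, z)` within `S` at `(0, z)`. [folklore] -/
theorem hasFDerivWithinAt_fst_smul_of_continuousWithinAt {M : ℝ × P → E} {S : Set (ℝ × P)}
    {z : P} (hM : ContinuousWithinAt M S (0, z)) :
    HasFDerivWithinAt (fun p : ℝ × P => p.1 • M p)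
      ((ContinuousLinearMap.fst ℝ ℝ P).smulRight (M (0, z))) S (0, z) := by
  refine .of_isLittleO ?_
  rw [Asymptotics.isLittleO_iff]
  intro ε hε
  have hev : ∀ᶠ p in 𝓝[S] ((0 : ℝ), z), dist (M p) (M (0, z)) < ε :=
    (Metric.tendsto_nhds.1 hM) ε hε
  filter_upwards [hev] with p hp
  rw [dist_eq_norm] at hp
  have e : p.1 • M p - (0 : ℝ) • M (0, z) -
      (ContinuousLinearMap.fst ℝ ℝ P).smulRight (M (0, z)) (p - (0, z)) =
      p.1 • (M p - M (0, z)) := by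
    simp only [zero_smul, sub_zero, ContinuousLinearMap.smulRight_apply,
      ContinuousLinearMap.coe_fst', Prod.fst_sub, smul_sub]
  rw [e, norm_smul]
  have h1 : ‖p.1‖ ≤ ‖p - (0, z)‖ := by
    have : ‖(p - (0, z)).1‖ ≤ ‖p - (0, z)‖ := norm_fst_le _
    simpa using this
  calc ‖p.1‖ * ‖M p - M (0, z)‖ ≤ ‖p - (0, z)‖ * ε :=
        mul_le_mul h1 hp.le (norm_nonneg _) (norm_nonneg _)
    _ = ε * ‖p - (0, z)‖ := mul_comm _ _

/-- Splitting a linear map on `ℝ × P` along the two factors: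
`T (a, b) = a • T (1, 0) + T (0, b)`. [folklore] -/
theorem clm_prod_apply_split (T : ℝ × P →L[ℝ] E) (a : ℝ) (b : P) :
    T (a, b) = a • T ((1 : ℝ), (0 : P)) + T ((0 : ℝ), b) := by
  have e : ((a, b) : ℝ × P) = a • ((1 : ℝ), (0 : P)) + ((0 : ℝ), b) := by simp
  rw [e, map_add, map_smul]

/-! ### Whitney's theorem for even functions (smooth, one-sided, with parameters) -/

section Whitney

variable [FiniteDimensional ℝ P]

/-- **Whitney's theorem, finite orders** (H. Whitney, Duke Math. J. 10 (1943), Thm. 1, smooth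
case, with a parameter): for every `n : ℕ`, every complete `E` and every even smooth
`F : ℝ × P → E`, the function `(s, z) ↦ F (√s, z)` is `Cⁿ` on the half-space `{s ≥ 0}`.
Induction on `n` for all `(E, F)` at once; see the module docstring. [folklore] -/
theorem contDiffOn_comp_sqrt_of_even_nat (n : ℕ) :
    ∀ {E : Type u} [NormedAddCommGroup E] [NormedSpace ℝ E] [CompleteSpace E] (F : ℝ × P → E),
      ContDiff ℝ ∞ F → (∀ ρ (z : P), F (-ρ, z) = F (ρ, z)) →
      ContDiffOn ℝ n (fun p : ℝ × P => F (Real.sqrt p.1, p.2)) (Ici 0 ×ˢ univ) := by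
  induction n with
  | zero =>
    intro E _ _ _ F hF _
    have h : ContDiffOn ℝ 0 (fun p : ℝ × P => F (Real.sqrt p.1, p.2)) (Ici 0 ×ˢ univ) := by
      rw [contDiffOn_zero]
      exact (hF.continuous.comp (by fun_prop)).continuousOn
    simpa using h
  | succ n ih =>
    intro E _ _ _ F hF heven
    set S : Set (ℝ × P) := Ici 0 ×ˢ univ with hS
    have hSu : UniqueDiffOn ℝ S := (uniqueDiffOn_Ici 0).prod uniqueDiffOn_univ
    have hFd : Differentiable ℝ F := hF.differentiable (by simp)
    have hF1 : ContDiff ℝ 1 F := hF.of_le (by simp)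
    -- `∂ᵨF` is odd; the Hadamard quotients `A` (odd) and `B` (even)
    have hdF_odd : ∀ ρ (z : P), fderiv ℝ F (-ρ, z) ((1 : ℝ), (0 : P)) =
        -fderiv ℝ F (ρ, z) ((1 : ℝ), (0 : P)) := fderiv_fst_neg_of_even hFd heven
    set A : ℝ × P → E := fun p =>
      ∫ t in (0 : ℝ)..1, fderiv ℝ F (t * p.1, p.2) ((1 : ℝ), (0 : P)) with hA
    have hAs : ContDiff ℝ ∞ A := contDiff_integral_fderiv_fst hF
    have hAd : Differentiable ℝ A := hAs.differentiable (by simp)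
    have hA_rep : ∀ ρ (z : P), ρ • A (ρ, z) = F (ρ, z) - F (0, z) := fun ρ z =>
      smul_integral_fderiv_fst_eq_sub hF1 ρ z
    have hA_odd : ∀ ρ (z : P), A (-ρ, z) = -A (ρ, z) := fun ρ z =>
      integral_fderiv_fst_odd hdF_odd ρ z
    have hA0 : ∀ z : P, A (0, z) = 0 := eq_zero_of_odd hA_odd
    set B : ℝ × P → E := fun p =>
      ∫ t in (0 : ℝ)..1, fderiv ℝ A (t * p.1, p.2) ((1 : ℝ), (0 : P)) with hB
    have hBs : ContDiff ℝ ∞ B := contDiff_integral_fderiv_fst hAs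
    have hBd : Differentiable ℝ B := hBs.differentiable (by simp)
    have hB_rep : ∀ ρ (z : P), ρ • B (ρ, z) = A (ρ, z) := fun ρ z => by
      have h := smul_integral_fderiv_fst_eq_sub (hAs.of_le (by simp)) ρ z
      rw [hA0, sub_zero] at h
      exact h
    have hB_even : ∀ ρ (z : P), B (-ρ, z) = B (ρ, z) := fun ρ z =>
      integral_fderiv_fst_even (fderiv_fst_eq_of_odd hAd hA_odd) ρ z
    -- the representation `F (ρ, z) = F (0, z) + ρ² • B (ρ, z)`
    have hrep : ∀ ρ (z : P), F (ρ, z) = F (0, z) + (ρ * ρ) • B (ρ, z) := fun ρ z => by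
      rw [mul_smul, hB_rep, hA_rep]
      abel
    -- the even smooth functions `C` and `D`
    set C : ℝ × P → E := fun p => B p + (p.1 / 2) • fderiv ℝ B p ((1 : ℝ), (0 : P)) with hC
    set D : ℝ × P → (P →L[ℝ] E) := fun p =>
      (fderiv ℝ F (0, p.2)).comp (ContinuousLinearMap.inr ℝ ℝ P) +
        (p.1 * p.1) • (fderiv ℝ B p).comp (ContinuousLinearMap.inr ℝ ℝ P) with hD
    have hdBs : ContDiff ℝ ∞ (fun p : ℝ × P => fderiv ℝ B p ((1 : ℝ), (0 : P))) :=
      (hBs.fderiv_right (m := ∞) (by simp)).clm_apply contDiff_const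
    have hCs : ContDiff ℝ ∞ C := hBs.add ((contDiff_fst.div_const 2).smul hdBs)
    have hDs : ContDiff ℝ ∞ D := by
      have h1 : ContDiff ℝ ∞ (fun p : ℝ × P => fderiv ℝ F (0, p.2)) :=
        (hF.fderiv_right (m := ∞) (by simp)).comp (contDiff_const.prodMk contDiff_snd)
      have h2 : ContDiff ℝ ∞ (fun p : ℝ × P => fderiv ℝ B p) := hBs.fderiv_right (m := ∞) (by simp)
      exact (h1.clm_comp contDiff_const).add
        ((contDiff_fst.mul contDiff_fst).smul (h2.clm_comp contDiff_const))
    have hC_even : ∀ ρ (z : P), C (-ρ, z) = C (ρ, z) := fun ρ z => by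
      have h1 := hB_even ρ z
      have h2 := fderiv_fst_neg_of_even hBd hB_even ρ z
      simp only [hC, h1, h2, smul_neg, neg_div, neg_smul, neg_neg]
    have hD_even : ∀ ρ (z : P), D (-ρ, z) = D (ρ, z) := fun ρ z => by
      have h2 : (fderiv ℝ B (-ρ, z)).comp (ContinuousLinearMap.inr ℝ ℝ P) =
          (fderiv ℝ B (ρ, z)).comp (ContinuousLinearMap.inr ℝ ℝ P) := by
        ext ζ
        simp only [ContinuousLinearMap.coe_comp, Function.comp_apply,
          ContinuousLinearMap.inr_apply]
        exact fderiv_snd_eq_of_even hBd hB_even ρ z ζ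
      simp only [hD, h2, neg_mul_neg]
    -- the functions `G`, `G'` and the candidate derivative `L`
    set L : ℝ × P → (ℝ × P →L[ℝ] E) := fun p =>
      (ContinuousLinearMap.fst ℝ ℝ P).smulRight (C (Real.sqrt p.1, p.2)) +
        (D (Real.sqrt p.1, p.2)).comp (ContinuousLinearMap.snd ℝ ℝ P) with hL
    set G : ℝ × P → E := fun p => F (Real.sqrt p.1, p.2) with hG
    set G' : ℝ × P → E := fun p => F (0, p.2) + p.1 • B (Real.sqrt p.1, p.2) with hG'
    have hGG' : ∀ p ∈ S, G p = G' p := fun p hp => by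
      have hp0 : 0 ≤ p.1 := hp.1
      simp only [hG, hG']
      rw [hrep (Real.sqrt p.1) p.2, Real.mul_self_sqrt hp0]
    -- the derivative of `G'` within `S`
    have hderiv : ∀ p ∈ S, HasFDerivWithinAt G' (L p) S p := by
      intro p hp
      have hp0 : 0 ≤ p.1 := hp.1
      -- the `F (0, ·)` part
      have h0 : HasFDerivAt (fun q : ℝ × P => F (0, q.2))
          ((fderiv ℝ F (0, p.2)).comp
            ((0 : ℝ × P →L[ℝ] ℝ).prod (ContinuousLinearMap.snd ℝ ℝ P))) p := by
        have hl : HasFDerivAt (fun q : ℝ × P => (((0 : ℝ), q.2) : ℝ × P))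
            ((0 : ℝ × P →L[ℝ] ℝ).prod (ContinuousLinearMap.snd ℝ ℝ P)) p :=
          (hasFDerivAt_const (0 : ℝ) p).prodMk hasFDerivAt_snd
        exact (hFd (0, p.2)).hasFDerivAt.comp p hl
      rcases hp0.eq_or_lt with hz | hpos
      · -- boundary point `p = (0, z)`
        obtain ⟨s, z⟩ := p
        simp only at hz
        subst hz
        have hM : ContinuousWithinAt (fun q : ℝ × P => B (Real.sqrt q.1, q.2)) S (0, z) :=
          (hBs.continuous.comp (by fun_prop)).continuousAt.continuousWithinAt
        have h1 := hasFDerivWithinAt_fst_smul_of_continuousWithinAt (S := S) hM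
        have h2 := (h0.hasFDerivWithinAt (s := S)).add h1
        refine h2.congr_fderiv (ContinuousLinearMap.ext fun v => ?_)
        obtain ⟨σ, ζ⟩ := v
        simp only [hL, hC, hD]
        change fderiv ℝ F (0, z) ((0 : ℝ), ζ) + σ • B (Real.sqrt 0, z) =
          σ • (B (Real.sqrt 0, z) + (Real.sqrt 0 / 2) • fderiv ℝ B (Real.sqrt 0, z) (1, 0)) +
            (fderiv ℝ F (0, z) ((0 : ℝ), ζ) +
              (Real.sqrt 0 * Real.sqrt 0) • fderiv ℝ B (Real.sqrt 0, z) ((0 : ℝ), ζ))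
        simp only [Real.sqrt_zero, zero_div, zero_smul, add_zero, mul_zero]
        rw [add_comm]
      · -- `p.1 > 0`: chain rule through `√`
        have hΨ : HasFDerivAt (fun q : ℝ × P => ((Real.sqrt q.1, q.2) : ℝ × P))
            ((((1 / (2 * Real.sqrt p.1)) • (1 : ℝ →L[ℝ] ℝ)).comp
              (ContinuousLinearMap.fst ℝ ℝ P)).prod (ContinuousLinearMap.snd ℝ ℝ P)) p := by
          have h1 : HasFDerivAt (fun q : ℝ × P => Real.sqrt q.1)
              (((1 / (2 * Real.sqrt p.1)) • (1 : ℝ →L[ℝ] ℝ)).comp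
                (ContinuousLinearMap.fst ℝ ℝ P)) p := by
            have hs := (Real.hasDerivAt_sqrt hpos.ne').hasFDerivAt
            have h := hs.comp p hasFDerivAt_fst
            refine h.congr_fderiv (ContinuousLinearMap.ext fun v => ?_)
            change (ContinuousLinearMap.fst ℝ ℝ P v) • (1 / (2 * Real.sqrt p.1)) =
              (1 / (2 * Real.sqrt p.1)) • (ContinuousLinearMap.fst ℝ ℝ P v)
            rw [smul_eq_mul, smul_eq_mul, mul_comm]
          exact h1.prodMk hasFDerivAt_snd
        have hBΨ : HasFDerivAt (B ∘ fun q : ℝ × P => ((Real.sqrt q.1, q.2) : ℝ × P))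
            ((fderiv ℝ B (Real.sqrt p.1, p.2)).comp
              ((((1 / (2 * Real.sqrt p.1)) • (1 : ℝ →L[ℝ] ℝ)).comp
                (ContinuousLinearMap.fst ℝ ℝ P)).prod (ContinuousLinearMap.snd ℝ ℝ P))) p :=
          (hBd (Real.sqrt p.1, p.2)).hasFDerivAt.comp p hΨ
        have hsmul := (hasFDerivAt_fst (p := p) (𝕜 := ℝ) (E := ℝ) (F := P)).smul hBΨ
        have h2 := (h0.add hsmul).hasFDerivWithinAt (s := S)
        refine h2.congr_fderiv ?_
        have hss : Real.sqrt p.1 * Real.sqrt p.1 = p.1 := Real.mul_self_sqrt hpos.le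
        have hsq : Real.sqrt p.1 ≠ 0 := (Real.sqrt_pos.2 hpos).ne'
        refine ContinuousLinearMap.ext fun v => ?_
        obtain ⟨σ, ζ⟩ := v
        simp only [hL, hC, hD]
        change fderiv ℝ F (0, p.2) ((0 : ℝ), ζ) +
            (p.1 • fderiv ℝ B (Real.sqrt p.1, p.2) ((1 / (2 * Real.sqrt p.1)) • σ, ζ) +
              σ • B (Real.sqrt p.1, p.2)) =
          σ • (B (Real.sqrt p.1, p.2) +
              (Real.sqrt p.1 / 2) • fderiv ℝ B (Real.sqrt p.1, p.2) (1, 0)) +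
            (fderiv ℝ F (0, p.2) ((0 : ℝ), ζ) +
              (Real.sqrt p.1 * Real.sqrt p.1) • fderiv ℝ B (Real.sqrt p.1, p.2) ((0 : ℝ), ζ))
        rw [clm_prod_apply_split (fderiv ℝ B (Real.sqrt p.1, p.2)) ((1 / (2 * Real.sqrt p.1)) • σ) ζ,
          smul_add, smul_smul, smul_add, smul_smul, hss]
        have e1 : p.1 * ((1 / (2 * Real.sqrt p.1)) • σ) = σ * (Real.sqrt p.1 / 2) := by
          rw [smul_eq_mul]
          calc p.1 * (1 / (2 * Real.sqrt p.1) * σ)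
              = Real.sqrt p.1 * Real.sqrt p.1 * (1 / (2 * Real.sqrt p.1) * σ) := by rw [hss]
            _ = σ * (Real.sqrt p.1 / 2) := by field_simp
        rw [e1]
        abel
    -- conclusion of the induction step
    have hderivG : ∀ p ∈ S, HasFDerivWithinAt G (L p) S p := fun p hp =>
      (hderiv p hp).congr (fun q hq => hGG' q hq) (hGG' p hp)
    have hLs : ContDiffOn ℝ n L S := by
      have h1 : ContDiffOn ℝ n (fun p : ℝ × P => C (Real.sqrt p.1, p.2)) S := ih C hCs hC_even
      have h2 : ContDiffOn ℝ n (fun p : ℝ × P => D (Real.sqrt p.1, p.2)) S := ih D hDs hD_even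
      have h3 : ContDiffOn ℝ n (fun p : ℝ × P =>
          (ContinuousLinearMap.fst ℝ ℝ P).smulRight (C (Real.sqrt p.1, p.2))) S :=
        contDiffOn_const.smulRight h1
      have h4 : ContDiffOn ℝ n (fun p : ℝ × P =>
          (D (Real.sqrt p.1, p.2)).comp (ContinuousLinearMap.snd ℝ ℝ P)) S :=
        h2.clm_comp contDiffOn_const
      exact h3.add h4
    have hcast : ((n + 1 : ℕ) : WithTop ℕ∞) = (n : WithTop ℕ∞) + 1 := by push_cast; rfl
    rw [hcast, contDiffOn_succ_iff_fderivWithin hSu]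
    refine ⟨fun p hp => (hderivG p hp).differentiableWithinAt, fun h => absurd h (by simp), ?_⟩
    exact hLs.congr fun p hp => (hderivG p hp).fderivWithin (hSu p hp)

/-- **Whitney's theorem on even functions, smooth case, with parameters** (H. Whitney, Duke
Math. J. 10 (1943), Thm. 1: "an even function `f(x)` may be written as `g(x²)` … if `f` is of
class `C^∞`, `g` may be made of class `C^∞`"; here vector-valued, uniformly in a parameter
`z ∈ P`, and on the closed half-space in the sense of `ContDiffOn`): if `F : ℝ × P → E` is smooth
and `F (−ρ, z) = F (ρ, z)`, then `(s, z) ↦ F (√s, z)` is `C^∞` on `{s ≥ 0}`. [folklore] -/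
theorem contDiffOn_comp_sqrt_of_even {E : Type u} [NormedAddCommGroup E] [NormedSpace ℝ E]
    [CompleteSpace E] {F : ℝ × P → E} (hF : ContDiff ℝ ∞ F)
    (heven : ∀ ρ (z : P), F (-ρ, z) = F (ρ, z)) :
    ContDiffOn ℝ ∞ (fun p : ℝ × P => F (Real.sqrt p.1, p.2)) (Ici 0 ×ˢ univ) :=
  contDiffOn_infty.2 fun n => contDiffOn_comp_sqrt_of_even_nat n F hF heven

/-- **Even smooth functions of a norm are smooth.** If `F : ℝ × P → E` is smooth and even in the
first variable, `X` is a real inner product space and `z : X → P` is smooth, then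
`x ↦ F (‖m x‖, z x)` is smooth for every continuous linear `m : X →L[ℝ] Y` into an inner product
space `Y` (e.g. the horizontal projection of `ℝ³`, `‖m x‖ = cylRadius x`): `‖m x‖ = √(‖m x‖²)`
with `‖m x‖²` smooth and nonnegative, and Whitney's theorem applies through the chain rule within
the half-space. [folklore] -/
theorem contDiff_comp_norm_of_even {E : Type u} [NormedAddCommGroup E] [NormedSpace ℝ E]
    [CompleteSpace E] {F : ℝ × P → E} (hF : ContDiff ℝ ∞ F)
    (heven : ∀ ρ (z : P), F (-ρ, z) = F (ρ, z))
    {X Y : Type*} [NormedAddCommGroup X] [NormedSpace ℝ X] [NormedAddCommGroup Y]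
    [InnerProductSpace ℝ Y] (m : X →L[ℝ] Y) {z : X → P} (hz : ContDiff ℝ ∞ z) :
    ContDiff ℝ ∞ (fun x : X => F (‖m x‖, z x)) := by
  have hG := contDiffOn_comp_sqrt_of_even hF heven
  have hm : ContDiff ℝ ∞ (fun x : X => ((‖m x‖ ^ 2, z x) : ℝ × P)) :=
    ((contDiff_norm_sq ℝ).comp m.contDiff).prodMk hz
  have hmaps : ∀ x : X, ((‖m x‖ ^ 2, z x) : ℝ × P) ∈ Ici (0 : ℝ) ×ˢ (univ : Set P) := fun x =>
    ⟨mem_Ici.2 (sq_nonneg ‖m x‖), mem_univ _⟩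
  have h : ContDiff ℝ ∞ ((fun p : ℝ × P => F (Real.sqrt p.1, p.2)) ∘
      fun x : X => ((‖m x‖ ^ 2, z x) : ℝ × P)) := hG.comp_contDiff hm hmaps
  have hfun : (fun x : X => F (‖m x‖, z x)) =
      ((fun p : ℝ × P => F (Real.sqrt p.1, p.2)) ∘ fun x : X => ((‖m x‖ ^ 2, z x) : ℝ × P)) := by
    funext x
    simp only [Function.comp_apply, Real.sqrt_sq (norm_nonneg _)]
  rw [hfun]
  exact h

end Whitney

end Literature.Analysis.Calculus

end
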